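import Summits.RiemannHypothesis.RiemannHypothesis.Theorems.TiltedLandingLaw421Seam06

/-! # TiltedLandingLaw421 — descent seam, part 07
Token-identical port of the descent framework of `Cruxes/TiltedLandingLaw421/Lines/law421birthS.lean`
(seam canon ce03e18b) into flat Theorems modules, so that crux line files can import it instead of inlining it.
No new mathematics; no `sorry`; no route (Theses) imports — the tree statement is mirrored as `RhW07.Seam.Law421Statement`. -/

open Complex Metric Set
open scoped ComplexConjugate
namespace RhIdea6.G19.W07C11.Seam
open Set Complex
open scoped ComplexConjugate
open RhIdea6.G17.W07C7 RhIdea6.G17.W07C7.Rev6 RhIdea6.G18.W07C8.Law421BirthS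
open RhW07.C11.DescentSplit.C3

/-- `FrozenS` — seam of the TiltedLandingLaw421 descent framework, part 07 (token-identical port of `Cruxes/TiltedLandingLaw421/Lines/law421birthS.lean`; no new mathematics). -/
def FrozenS (c₀ μ : ℝ) : StatePred := fun _η f _x₀ s _hmax _R _Hs _B j u => FrozenDownAt c₀ (μ * s) (iteratedDeriv j f) u

/-- `FrozenLocAt` — seam of the TiltedLandingLaw421 descent framework, part 07 (token-identical port of `Cruxes/TiltedLandingLaw421/Lines/law421birthS.lean`; no new mathematics). -/
def FrozenLocAt (c₀ d : ℝ) (g : ℂ → ℂ) (u : ℂ) : Prop :=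
  ∃ (h : ℂ → ℂ) (c : ℂ) (θ : ℝ), PairFactor g h u.re u.im ∧ 0 ≤ θ ∧ 2 ≤ ‖c‖ * u.im ∧ θ ≤ c₀ * ‖c‖ ∧
    (-1 / c).im ≤ -d ∧ ∀ z ∈ Metric.closedBall u (u.im / 2), h z ≠ 0 ∧ ‖deriv h z / h z - c‖ ≤ θ

/-- `FrozenLocS` — seam of the TiltedLandingLaw421 descent framework, part 07 (token-identical port of `Cruxes/TiltedLandingLaw421/Lines/law421birthS.lean`; no new mathematics). -/
def FrozenLocS (c₀ μ : ℝ) : StatePred := fun _η f _x₀ s _hmax _R _Hs _B j u => FrozenLocAt c₀ (μ * s) (iteratedDeriv j f) u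

/-- `frozenLocAt_of_frozenDownAt` — seam of the TiltedLandingLaw421 descent framework, part 07 (token-identical port of `Cruxes/TiltedLandingLaw421/Lines/law421birthS.lean`; no new mathematics). -/
theorem frozenLocAt_of_frozenDownAt {c₀ d : ℝ} {g : ℂ → ℂ} {u : ℂ} (hu : 0 ≤ u.im) (hF : FrozenDownAt c₀ d g u) :
    FrozenLocAt c₀ d g u := by
  obtain ⟨h, c, θ, hPF, hθ, hcu, hθc, him, hball⟩ := hF
  refine ⟨h, c, θ, hPF, hθ, hcu, hθc, him, fun z hz => hball z ?_⟩
  rw [Metric.mem_closedBall] at hz ⊢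
  have h1 : dist z (u.re : ℂ) ≤ dist z u + dist u (u.re : ℂ) := dist_triangle _ _ _
  have h2 : dist u (u.re : ℂ) = |u.im| := by
    rw [Complex.dist_eq]
    have : u - (u.re : ℂ) = (u.im : ℂ) * I := by apply Complex.ext <;> simp
    rw [this, norm_mul, Complex.norm_I, mul_one, Complex.norm_real, Real.norm_eq_abs]
  rw [h2, abs_of_nonneg hu] at h1
  linarith

/-- `frozenLocS_of_frozenS` — seam of the TiltedLandingLaw421 descent framework, part 07 (token-identical port of `Cruxes/TiltedLandingLaw421/Lines/law421birthS.lean`; no new mathematics). -/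
theorem frozenLocS_of_frozenS {c₀ μ : ℝ} {η : ℝ} {f : ℂ → ℂ} {x₀ s hmax R Hs : ℝ} {B j : ℕ} {u : ℂ}
    (hSt : StWin η f x₀ s hmax R Hs B j u) (hF : FrozenS c₀ μ η f x₀ s hmax R Hs B j u) : FrozenLocS c₀ μ η f x₀ s hmax R Hs B j u :=
  frozenLocAt_of_frozenDownAt hSt.2.2.1.le hF

/-- `init0Sig_stWin` — seam of the TiltedLandingLaw421 descent framework, part 07 (token-identical port of `Cruxes/TiltedLandingLaw421/Lines/law421birthS.lean`; no new mathematics). -/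
theorem init0Sig_stWin : Init0Sig StWin := by
  intro η f x₀ s hmax R Hs B hE
  obtain ⟨hdiff, hreal, -, hs, hsh, -, h3R, hHs, hstrip, -, ⟨w₀, hw0, hwim, hwre, hwh⟩, -⟩ := hE
  have hf : iteratedDeriv 0 f ≠ 0 := by
    intro hf0
    rw [iteratedDeriv_zero] at hf0
    have h := hstrip ((Hs + 1 : ℝ) * I) (by rw [hf0]; rfl)
    have him : (((Hs + 1 : ℝ) : ℂ) * I).im = Hs + 1 := by simp
    rw [him, abs_of_nonneg (by linarith)] at h
    linarith
  have hR : |x₀ - x₀| ≤ (((0 : ℕ) : ℝ) + 2) * R / 2 := by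
    rw [sub_self, abs_zero]; push_cast; nlinarith
  have hwabs : |w₀.im| ≤ hmax := hwh
  rcases lt_or_gt_of_ne hwim with hneg | hpos
  · refine ⟨conj w₀, ⟨hf, ?_, ?_, ?_, ?_⟩, ?_⟩
    · rw [iteratedDeriv_zero, Literature.Analysis.Complex.apply_conj_eq_conj hdiff hreal, hw0, map_zero]
    · rw [Complex.conj_im]; linarith
    · rw [Complex.conj_re, hwre]; exact hR
    · rw [Complex.conj_im]; rw [abs_of_neg hneg] at hwabs; exact hwabs
    · rw [Complex.conj_im, abs_neg]; exact hwh
  · refine ⟨w₀, ⟨hf, ?_, hpos, ?_, ?_⟩, hwh⟩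
    · rw [iteratedDeriv_zero]; exact hw0
    · rw [hwre]; exact hR
    · exact le_trans (le_abs_self _) hwh

/-- `landSig_stWin` — seam of the TiltedLandingLaw421 descent framework, part 07 (token-identical port of `Cruxes/TiltedLandingLaw421/Lines/law421birthS.lean`; no new mathematics). -/
theorem landSig_stWin : LandSig StWin WindowReady :=
  landSig_windowReady StWin (fun _ _ _ _ _ _ _ _ _ _ h => h.1)

/-- `frozenDownAt_mono` — seam of the TiltedLandingLaw421 descent framework, part 07 (token-identical port of `Cruxes/TiltedLandingLaw421/Lines/law421birthS.lean`; no new mathematics). -/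
theorem frozenDownAt_mono {c₀ c₀' d : ℝ} (h : c₀ ≤ c₀') {g : ℂ → ℂ} {u : ℂ} (hF : FrozenDownAt c₀ d g u) :
    FrozenDownAt c₀' d g u := by
  obtain ⟨hh, c, θ, hPF, hθ, hcu, hθc, him, hball⟩ := hF
  exact ⟨hh, c, θ, hPF, hθ, hcu, le_trans hθc (mul_le_mul_of_nonneg_right h (norm_nonneg _)), him, hball⟩

/-- `surplusSig_frozenS_mono` — seam of the TiltedLandingLaw421 descent framework, part 07 (token-identical port of `Cruxes/TiltedLandingLaw421/Lines/law421birthS.lean`; no new mathematics). -/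
theorem surplusSig_frozenS_mono {cE c₀ c₀' μ : ℝ} (h : c₀ ≤ c₀') (St Ready : StatePred)
    (hS : SurplusSig cE St Ready (FrozenS c₀ μ)) : SurplusSig cE St Ready (FrozenS c₀' μ) := by
  intro η f x₀ s hmax R Hs B hE
  obtain ⟨E, hcard, hoff⟩ := hS η f x₀ s hmax R Hs B hE
  refine ⟨E, hcard, fun j u hjE hSt => ?_⟩
  rcases hoff j u hjE hSt with hR | hF
  · exact Or.inl hR
  · exact Or.inr (frozenDownAt_mono h hF)

/-- `frozenStepSig_frozenS_mono` — seam of the TiltedLandingLaw421 descent framework, part 07 (token-identical port of `Cruxes/TiltedLandingLaw421/Lines/law421birthS.lean`; no new mathematics). -/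
theorem frozenStepSig_frozenS_mono {c₀ c₀' μ μ' : ℝ} (h : c₀ ≤ c₀') (St Ready : StatePred)
    (hF : FrozenStepSig μ' St Ready (FrozenS c₀' μ)) : FrozenStepSig μ' St Ready (FrozenS c₀ μ) := by
  intro η f x₀ s hmax R Hs B hE j u hSt hFz hR
  exact hF η f x₀ s hmax R Hs B hE j u hSt (frozenDownAt_mono h hFz) hR

/-- `frozenLocAt_mono` — seam of the TiltedLandingLaw421 descent framework, part 07 (token-identical port of `Cruxes/TiltedLandingLaw421/Lines/law421birthS.lean`; no new mathematics). -/
theorem frozenLocAt_mono {c₀ c₀' d : ℝ} (h : c₀ ≤ c₀') {g : ℂ → ℂ} {u : ℂ} (hF : FrozenLocAt c₀ d g u) :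
    FrozenLocAt c₀' d g u := by
  obtain ⟨hh, c, θ, hPF, hθ, hcu, hθc, him, hball⟩ := hF
  exact ⟨hh, c, θ, hPF, hθ, hcu, le_trans hθc (mul_le_mul_of_nonneg_right h (norm_nonneg _)), him, hball⟩

/-- `surplusSig_frozenLocS_mono` — seam of the TiltedLandingLaw421 descent framework, part 07 (token-identical port of `Cruxes/TiltedLandingLaw421/Lines/law421birthS.lean`; no new mathematics). -/
theorem surplusSig_frozenLocS_mono {cE c₀ c₀' μ : ℝ} (h : c₀ ≤ c₀') (St Ready : StatePred)
    (hS : SurplusSig cE St Ready (FrozenLocS c₀ μ)) : SurplusSig cE St Ready (FrozenLocS c₀' μ) := by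
  intro η f x₀ s hmax R Hs B hE
  obtain ⟨E, hcard, hoff⟩ := hS η f x₀ s hmax R Hs B hE
  refine ⟨E, hcard, fun j u hjE hSt => ?_⟩
  rcases hoff j u hjE hSt with hR | hF
  · exact Or.inl hR
  · exact Or.inr (frozenLocAt_mono h hF)

/-- `frozenStepSig_frozenLocS_mono` — seam of the TiltedLandingLaw421 descent framework, part 07 (token-identical port of `Cruxes/TiltedLandingLaw421/Lines/law421birthS.lean`; no new mathematics). -/
theorem frozenStepSig_frozenLocS_mono {c₀ c₀' μ μ' : ℝ} (h : c₀ ≤ c₀') (St Ready : StatePred)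
    (hF : FrozenStepSig μ' St Ready (FrozenLocS c₀' μ)) : FrozenStepSig μ' St Ready (FrozenLocS c₀ μ) := by
  intro η f x₀ s hmax R Hs B hE j u hSt hFz hR
  exact hF η f x₀ s hmax R Hs B hE j u hSt (frozenLocAt_mono h hFz) hR

/-- `surplusSig_frozenLocS_of_frozenS` — seam of the TiltedLandingLaw421 descent framework, part 07 (token-identical port of `Cruxes/TiltedLandingLaw421/Lines/law421birthS.lean`; no new mathematics). -/
theorem surplusSig_frozenLocS_of_frozenS {cE c₀ μ : ℝ} (Ready : StatePred)
    (hS : SurplusSig cE StWin Ready (FrozenS c₀ μ)) : SurplusSig cE StWin Ready (FrozenLocS c₀ μ) := by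
  intro η f x₀ s hmax R Hs B hE
  obtain ⟨E, hcard, hoff⟩ := hS η f x₀ s hmax R Hs B hE
  refine ⟨E, hcard, fun j u hjE hSt => ?_⟩
  rcases hoff j u hjE hSt with hR | hF
  · exact Or.inl hR
  · exact Or.inr (frozenLocS_of_frozenS hSt hF)

/-- `StPair` — seam of the TiltedLandingLaw421 descent framework, part 07 (token-identical port of `Cruxes/TiltedLandingLaw421/Lines/law421birthS.lean`; no new mathematics). -/
def StPair : StatePred := fun _η f x₀ _s hmax R _Hs _B j u => iteratedDeriv j f ≠ 0 ∧ PairAt f j x₀ R hmax u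

/-- `ReadyBoxS` — seam of the TiltedLandingLaw421 descent framework, part 07 (token-identical port of `Cruxes/TiltedLandingLaw421/Lines/law421birthS.lean`; no new mathematics). -/
def ReadyBoxS : StatePred := fun _η f _x₀ _s _hmax R _Hs _B j u => ClearBoxReadyAt (R / 2) (iteratedDeriv j f) u

/-- `surplusSig_of_pSurplusBox` — seam of the TiltedLandingLaw421 descent framework, part 07 (token-identical port of `Cruxes/TiltedLandingLaw421/Lines/law421birthS.lean`; no new mathematics). -/
theorem surplusSig_of_pSurplusBox (c₀ μ : ℝ) (h : PSurplusBox c₀ μ) : SurplusSig 0 StPair ReadyBoxS (FrozenS c₀ μ) := by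
  intro η f x₀ s hmax R Hs B hE
  obtain ⟨E, hcard, hoff⟩ := h η f x₀ s hmax R Hs B hE
  exact ⟨E, by linarith, fun j u hjE hSt => hoff j u hjE hSt.1 hSt.2⟩

/-- `landSig_readyBoxS` — seam of the TiltedLandingLaw421 descent framework, part 07 (token-identical port of `Cruxes/TiltedLandingLaw421/Lines/law421birthS.lean`; no new mathematics). -/
theorem landSig_readyBoxS : LandSig StPair ReadyBoxS := by
  intro η f x₀ s hmax R Hs B _ j u hSt hR
  exact ⟨hSt.1, descent_exit_of_clearBoxReady hSt.2 hR⟩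

/-- `windowReady_of_readyBoxS` — seam of the TiltedLandingLaw421 descent framework, part 07 (token-identical port of `Cruxes/TiltedLandingLaw421/Lines/law421birthS.lean`; no new mathematics). -/
theorem windowReady_of_readyBoxS (η : ℝ) (f : ℂ → ℂ) (x₀ s hmax R Hs : ℝ) (B j : ℕ) (u : ℂ)
    (hSt : StPair η f x₀ s hmax R Hs B j u) (hR : ReadyBoxS η f x₀ s hmax R Hs B j u) : WindowReady η f x₀ s hmax R Hs B j u :=
  descent_exit_of_clearBoxReady hSt.2 hR

/-- `TiltedLandingLaw421_of_pieces` — seam of the TiltedLandingLaw421 descent framework, part 07 (token-identical port of `Cruxes/TiltedLandingLaw421/Lines/law421birthS.lean`; no new mathematics). -/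
private theorem TiltedLandingLaw421_of_pieces :
    SurplusSig 0 StWin WindowReady (FrozenLocS cStar muF) → FrozenStepSig (1 / 4) StWin WindowReady (FrozenLocS cStar muF) →
      HoldStepSig StWin WindowReady → AnalyticHereditySig →
        RhW07.Seam.Law421Statement :=
  fun hC hF hH hHer =>
    law421T_of_surplus_pieces (1 / 4) le_rfl StWin WindowReady (FrozenLocS cStar muF) init0Sig_stWin hC hF hH landSig_stWin hHer

/-- `descentSigS_of_pieces` — seam of the TiltedLandingLaw421 descent framework, part 07 (token-identical port of `Cruxes/TiltedLandingLaw421/Lines/law421birthS.lean`; no new mathematics). -/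
theorem descentSigS_of_pieces :
    SurplusSig 0 StWin WindowReady (FrozenLocS cStar muF) → FrozenStepSig (1 / 4) StWin WindowReady (FrozenLocS cStar muF) →
      HoldStepSig StWin WindowReady → DescentSigS :=
  fun hC hF hH =>
    descentSigS_of_surplus_pieces (1 / 4) le_rfl StWin WindowReady (FrozenLocS cStar muF) init0Sig_stWin hC hF hH landSig_stWin

/-- `nStar` — seam of the TiltedLandingLaw421 descent framework, part 07 (token-identical port of `Cruxes/TiltedLandingLaw421/Lines/law421birthS.lean`; no new mathematics). -/
noncomputable def nStar : ℝ := 3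

/-- `StCol` — seam of the TiltedLandingLaw421 descent framework, part 07 (token-identical port of `Cruxes/TiltedLandingLaw421/Lines/law421birthS.lean`; no new mathematics). -/
def StCol : StatePred := fun _η f x₀ s hmax R _Hs _B j u =>
  iteratedDeriv j f ≠ 0 ∧ iteratedDeriv j f u = 0 ∧ 0 < u.im ∧ |u.re - x₀| ≤ R / 2 + (j : ℝ) * (s / 4) ∧ u.im ≤ hmax

/-- `FrozenLocAt'` — seam of the TiltedLandingLaw421 descent framework, part 07 (token-identical port of `Cruxes/TiltedLandingLaw421/Lines/law421birthS.lean`; no new mathematics). -/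
def FrozenLocAt' (N c₀ d dr : ℝ) (g : ℂ → ℂ) (u : ℂ) : Prop :=
  ∃ (h : ℂ → ℂ) (c : ℂ) (θ : ℝ), PairFactor g h u.re u.im ∧ 0 ≤ θ ∧ N ≤ ‖c‖ * u.im ∧ θ ≤ c₀ * ‖c‖ ∧
    (-1 / c).im ≤ -d ∧ |(1 / c).re| ≤ dr ∧ ∀ z ∈ Metric.closedBall u (u.im / 2), h z ≠ 0 ∧ ‖deriv h z / h z - c‖ ≤ θ

/-- `FrozenLocS'` — seam of the TiltedLandingLaw421 descent framework, part 07 (token-identical port of `Cruxes/TiltedLandingLaw421/Lines/law421birthS.lean`; no new mathematics). -/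
def FrozenLocS' (c₀ μ : ℝ) : StatePred := fun _η f _x₀ s _hmax _R _Hs _B j u =>
  FrozenLocAt' nStar c₀ (μ * s) (s / 4) (iteratedDeriv j f) u

/-- `frozenLocAt_of_frozenLocAt'` — seam of the TiltedLandingLaw421 descent framework, part 07 (token-identical port of `Cruxes/TiltedLandingLaw421/Lines/law421birthS.lean`; no new mathematics). -/
theorem frozenLocAt_of_frozenLocAt' {N c₀ d dr : ℝ} (hN : 2 ≤ N) {g : ℂ → ℂ} {u : ℂ} (hF : FrozenLocAt' N c₀ d dr g u) :
    FrozenLocAt c₀ d g u := by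
  obtain ⟨h, c, θ, hPF, hθ, hcu, hθc, him, -, hball⟩ := hF
  exact ⟨h, c, θ, hPF, hθ, le_trans hN hcu, hθc, him, hball⟩

/-- `frozenLocS_of_frozenLocS'` — seam of the TiltedLandingLaw421 descent framework, part 07 (token-identical port of `Cruxes/TiltedLandingLaw421/Lines/law421birthS.lean`; no new mathematics). -/
theorem frozenLocS_of_frozenLocS' {c₀ μ : ℝ} {η : ℝ} {f : ℂ → ℂ} {x₀ s hmax R Hs : ℝ} {B j : ℕ} {u : ℂ}
    (hF : FrozenLocS' c₀ μ η f x₀ s hmax R Hs B j u) : FrozenLocS c₀ μ η f x₀ s hmax R Hs B j u :=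
  frozenLocAt_of_frozenLocAt' (by norm_num [nStar]) hF

/-- `frozenLocAt'_mono` — seam of the TiltedLandingLaw421 descent framework, part 07 (token-identical port of `Cruxes/TiltedLandingLaw421/Lines/law421birthS.lean`; no new mathematics). -/
theorem frozenLocAt'_mono {N N' c₀ c₀' d d' dr dr' : ℝ} (hN : N' ≤ N) (hc : c₀ ≤ c₀') (hd : d' ≤ d) (hdr : dr ≤ dr')
    {g : ℂ → ℂ} {u : ℂ} (hF : FrozenLocAt' N c₀ d dr g u) : FrozenLocAt' N' c₀' d' dr' g u := by
  obtain ⟨h, c, θ, hPF, hθ, hcu, hθc, him, hre, hball⟩ := hF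
  exact ⟨h, c, θ, hPF, hθ, le_trans hN hcu, le_trans hθc (mul_le_mul_of_nonneg_right hc (norm_nonneg _)), by linarith, le_trans hre hdr, hball⟩

/-- `init0Sig_stCol` — seam of the TiltedLandingLaw421 descent framework, part 07 (token-identical port of `Cruxes/TiltedLandingLaw421/Lines/law421birthS.lean`; no new mathematics). -/
theorem init0Sig_stCol : Init0Sig StCol := by
  intro η f x₀ s hmax R Hs B hE
  obtain ⟨hdiff, hreal, -, hs, hsh, -, h3R, hHs, hstrip, -, ⟨w₀, hw0, hwim, hwre, hwh⟩, -⟩ := hE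
  have hf : iteratedDeriv 0 f ≠ 0 := by
    intro hf0
    rw [iteratedDeriv_zero] at hf0
    have h := hstrip ((Hs + 1 : ℝ) * I) (by rw [hf0]; rfl)
    have him : (((Hs + 1 : ℝ) : ℂ) * I).im = Hs + 1 := by simp
    rw [him, abs_of_nonneg (by linarith)] at h
    linarith
  have hR : |x₀ - x₀| ≤ R / 2 + ((0 : ℕ) : ℝ) * (s / 4) := by
    rw [sub_self, abs_zero]; push_cast; nlinarith
  have hwabs : |w₀.im| ≤ hmax := hwh
  rcases lt_or_gt_of_ne hwim with hneg | hpos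
  · refine ⟨conj w₀, ⟨hf, ?_, ?_, ?_, ?_⟩, ?_⟩
    · rw [iteratedDeriv_zero, Literature.Analysis.Complex.apply_conj_eq_conj hdiff hreal, hw0, map_zero]
    · rw [Complex.conj_im]; linarith
    · rw [Complex.conj_re, hwre]; exact hR
    · rw [Complex.conj_im]; rw [abs_of_neg hneg] at hwabs; exact hwabs
    · rw [Complex.conj_im, abs_neg]; exact hwh
  · refine ⟨w₀, ⟨hf, ?_, hpos, ?_, ?_⟩, hwh⟩
    · rw [iteratedDeriv_zero]; exact hw0
    · rw [hwre]; exact hR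
    · exact le_trans (le_abs_self _) hwh

/-- `landSig_stCol` — seam of the TiltedLandingLaw421 descent framework, part 07 (token-identical port of `Cruxes/TiltedLandingLaw421/Lines/law421birthS.lean`; no new mathematics). -/
theorem landSig_stCol : LandSig StCol WindowReady :=
  landSig_windowReady StCol (fun _ _ _ _ _ _ _ _ _ _ h => h.1)

/-- `surplusLiftSig_frozenLocS'_mono` — seam of the TiltedLandingLaw421 descent framework, part 07 (token-identical port of `Cruxes/TiltedLandingLaw421/Lines/law421birthS.lean`; no new mathematics). -/
theorem surplusLiftSig_frozenLocS'_mono {cE c₀ c₀' μ : ℝ} (h : c₀ ≤ c₀') (Λ : ℝ → ℝ → ℝ) (St Ready : StatePred)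
    (hS : SurplusLiftSig cE Λ St Ready (FrozenLocS' c₀ μ)) : SurplusLiftSig cE Λ St Ready (FrozenLocS' c₀' μ) := by
  intro η f x₀ s hmax R Hs B hE
  obtain ⟨E, lam, hcard, hlam, hsum, hoff, hon⟩ := hS η f x₀ s hmax R Hs B hE
  refine ⟨E, lam, hcard, hlam, hsum, fun j u hjE hSt => ?_, hon⟩
  rcases hoff j u hjE hSt with hR | hF
  · exact Or.inl hR
  · exact Or.inr (frozenLocAt'_mono le_rfl h le_rfl le_rfl hF)

/-- `frozenStepSig_frozenLocS'_anti` — seam of the TiltedLandingLaw421 descent framework, part 07 (token-identical port of `Cruxes/TiltedLandingLaw421/Lines/law421birthS.lean`; no new mathematics). -/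
theorem frozenStepSig_frozenLocS'_anti {c₀ c₀' μ ν : ℝ} (h : c₀ ≤ c₀') (St Ready : StatePred)
    (hF : FrozenStepSig ν St Ready (FrozenLocS' c₀' μ)) : FrozenStepSig ν St Ready (FrozenLocS' c₀ μ) := by
  intro η f x₀ s hmax R Hs B hE j u hSt hFr hR
  exact hF η f x₀ s hmax R Hs B hE j u hSt (frozenLocAt'_mono le_rfl h le_rfl le_rfl hFr) hR

/-- `surplusLiftSigV_frozenLocS'_mono` — seam of the TiltedLandingLaw421 descent framework, part 07 (token-identical port of `Cruxes/TiltedLandingLaw421/Lines/law421birthS.lean`; no new mathematics). -/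
theorem surplusLiftSigV_frozenLocS'_mono {c₀ c₀' μ ν : ℝ} (h : c₀ ≤ c₀') (St Ready : StatePred)
    (hS : SurplusLiftSigV ν St Ready (FrozenLocS' c₀ μ)) : SurplusLiftSigV ν St Ready (FrozenLocS' c₀' μ) := by
  intro η f x₀ s hmax R Hs B hE
  obtain ⟨E, lam, hlam, hsum, hoff, hon⟩ := hS η f x₀ s hmax R Hs B hE
  refine ⟨E, lam, hlam, hsum, fun j u hjE hSt => ?_, hon⟩
  rcases hoff j u hjE hSt with hR | hF
  · exact Or.inl hR
  · exact Or.inr (frozenLocAt'_mono le_rfl h le_rfl le_rfl hF)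

/-- `TiltedLandingLaw421_of_piecesC` — seam of the TiltedLandingLaw421 descent framework, part 07 (token-identical port of `Cruxes/TiltedLandingLaw421/Lines/law421birthS.lean`; no new mathematics). -/
private theorem TiltedLandingLaw421_of_piecesC :
    SurplusLiftSig 0 (liftBudget (1 / 4) 0 1) StCol WindowReady (FrozenLocS' cStar muF) →
      FrozenStepSig (1 / 4) StCol WindowReady (FrozenLocS' cStar muF) → AnalyticHereditySig →
        RhW07.Seam.Law421Statement :=
  fun hL hF hHer =>
    law421T_ofS' (descentSigS'_of_lift_pieces (1 / 4) le_rfl StCol WindowReady (FrozenLocS' cStar muF) init0Sig_stCol hL hF landSig_stCol) hHer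

/-- `descentSigS'_of_piecesC` — seam of the TiltedLandingLaw421 descent framework, part 07 (token-identical port of `Cruxes/TiltedLandingLaw421/Lines/law421birthS.lean`; no new mathematics). -/
theorem descentSigS'_of_piecesC :
    SurplusLiftSig 0 (liftBudget (1 / 4) 0 1) StCol WindowReady (FrozenLocS' cStar muF) →
      FrozenStepSig (1 / 4) StCol WindowReady (FrozenLocS' cStar muF) → DescentSigS' :=
  fun hL hF => descentSigS'_of_lift_pieces (1 / 4) le_rfl StCol WindowReady (FrozenLocS' cStar muF) init0Sig_stCol hL hF landSig_stCol

/-- `TiltedLandingLaw421_of_piecesV` — seam of the TiltedLandingLaw421 descent framework, part 07 (token-identical port of `Cruxes/TiltedLandingLaw421/Lines/law421birthS.lean`; no new mathematics). -/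
private theorem TiltedLandingLaw421_of_piecesV :
    SurplusLiftSigV (1 / 4) StCol WindowReady (FrozenLocS' cStar muF) →
      FrozenStepSig (1 / 4) StCol WindowReady (FrozenLocS' cStar muF) → AnalyticHereditySig →
        RhW07.Seam.Law421Statement :=
  fun hL hF hHer =>
    law421T_ofS (descentSigS_of_liftV_pieces (1 / 4) le_rfl StCol WindowReady (FrozenLocS' cStar muF) init0Sig_stCol hL hF landSig_stCol) hHer

/-- `descentSigS_of_piecesV` — seam of the TiltedLandingLaw421 descent framework, part 07 (token-identical port of `Cruxes/TiltedLandingLaw421/Lines/law421birthS.lean`; no new mathematics). -/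
theorem descentSigS_of_piecesV :
    SurplusLiftSigV (1 / 4) StCol WindowReady (FrozenLocS' cStar muF) →
      FrozenStepSig (1 / 4) StCol WindowReady (FrozenLocS' cStar muF) → DescentSigS :=
  fun hL hF => descentSigS_of_liftV_pieces (1 / 4) le_rfl StCol WindowReady (FrozenLocS' cStar muF) init0Sig_stCol hL hF landSig_stCol

/-- `SuccS` — seam of the TiltedLandingLaw421 descent framework, part 07 (token-identical port of `Cruxes/TiltedLandingLaw421/Lines/law421birthS.lean`; no new mathematics). -/
def SuccS (μ : ℝ) : StatePred := fun η f x₀ s hmax R Hs B j u =>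
  ∃ u' : ℂ, StCol η f x₀ s hmax R Hs B (j + 1) u' ∧ |u'.im| + μ * s ≤ |u.im|

/-- `frozenStepSig_succS` — seam of the TiltedLandingLaw421 descent framework, part 07 (token-identical port of `Cruxes/TiltedLandingLaw421/Lines/law421birthS.lean`; no new mathematics). -/
theorem frozenStepSig_succS (μ : ℝ) (Ready : StatePred) : FrozenStepSig μ StCol Ready (SuccS μ) :=
  fun _ _ _ _ _ _ _ _ _ _ _ _ hF _ => hF

/-- `surplusLiftSig_succS_of_step` — seam of the TiltedLandingLaw421 descent framework, part 07 (token-identical port of `Cruxes/TiltedLandingLaw421/Lines/law421birthS.lean`; no new mathematics). -/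
theorem surplusLiftSig_succS_of_step {cE μ : ℝ} {Λ : ℝ → ℝ → ℝ} {Ready F : StatePred}
    (hS : SurplusLiftSig cE Λ StCol Ready F) (hF : FrozenStepSig μ StCol Ready F) : SurplusLiftSig cE Λ StCol Ready (SuccS μ) := by
  intro η f x₀ s hmax R Hs B hE
  obtain ⟨E, lam, hcard, hlam, hsum, hoff, hon⟩ := hS η f x₀ s hmax R Hs B hE
  refine ⟨E, lam, hcard, hlam, hsum, fun j u hjE hSt => ?_, hon⟩
  rcases hoff j u hjE hSt with hR | hFz
  · exact Or.inl hR
  · by_cases hR : Ready η f x₀ s hmax R Hs B j u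
    · exact Or.inl hR
    · exact Or.inr (hF η f x₀ s hmax R Hs B hE j u hSt hFz hR)

/-- `surplusLiftSigV_succS_of_step` — seam of the TiltedLandingLaw421 descent framework, part 07 (token-identical port of `Cruxes/TiltedLandingLaw421/Lines/law421birthS.lean`; no new mathematics). -/
theorem surplusLiftSigV_succS_of_step {μ ν : ℝ} {Ready F : StatePred}
    (hS : SurplusLiftSigV ν StCol Ready F) (hF : FrozenStepSig μ StCol Ready F) : SurplusLiftSigV ν StCol Ready (SuccS μ) := by
  intro η f x₀ s hmax R Hs B hE
  obtain ⟨E, lam, hlam, hsum, hoff, hon⟩ := hS η f x₀ s hmax R Hs B hE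
  refine ⟨E, lam, hlam, hsum, fun j u hjE hSt => ?_, hon⟩
  rcases hoff j u hjE hSt with hR | hFz
  · exact Or.inl hR
  · by_cases hR : Ready η f x₀ s hmax R Hs B j u
    · exact Or.inl hR
    · exact Or.inr (hF η f x₀ s hmax R Hs B hE j u hSt hFz hR)

/-- `TiltedLandingLaw421_of_piecesS` — seam of the TiltedLandingLaw421 descent framework, part 07 (token-identical port of `Cruxes/TiltedLandingLaw421/Lines/law421birthS.lean`; no new mathematics). -/
private theorem TiltedLandingLaw421_of_piecesS :
    SurplusLiftSig 0 (liftBudget (1 / 4) 0 1) StCol WindowReady (SuccS (1 / 4)) → AnalyticHereditySig →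
      RhW07.Seam.Law421Statement :=
  fun hL hHer =>
    law421T_ofS' (descentSigS'_of_lift_pieces (1 / 4) le_rfl StCol WindowReady (SuccS (1 / 4)) init0Sig_stCol hL
      (frozenStepSig_succS (1 / 4) WindowReady) landSig_stCol) hHer

/-- `descentSigS'_of_piecesS` — seam of the TiltedLandingLaw421 descent framework, part 07 (token-identical port of `Cruxes/TiltedLandingLaw421/Lines/law421birthS.lean`; no new mathematics). -/
theorem descentSigS'_of_piecesS :
    SurplusLiftSig 0 (liftBudget (1 / 4) 0 1) StCol WindowReady (SuccS (1 / 4)) → DescentSigS' :=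
  fun hL => descentSigS'_of_lift_pieces (1 / 4) le_rfl StCol WindowReady (SuccS (1 / 4)) init0Sig_stCol hL
    (frozenStepSig_succS (1 / 4) WindowReady) landSig_stCol

/-- `TiltedLandingLaw421_of_piecesSV` — seam of the TiltedLandingLaw421 descent framework, part 07 (token-identical port of `Cruxes/TiltedLandingLaw421/Lines/law421birthS.lean`; no new mathematics). -/
private theorem TiltedLandingLaw421_of_piecesSV :
    SurplusLiftSigV (1 / 4) StCol WindowReady (SuccS (1 / 4)) → AnalyticHereditySig →
      RhW07.Seam.Law421Statement :=
  fun hL hHer =>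
    law421T_ofS (descentSigS_of_liftV_pieces (1 / 4) le_rfl StCol WindowReady (SuccS (1 / 4)) init0Sig_stCol hL
      (frozenStepSig_succS (1 / 4) WindowReady) landSig_stCol) hHer

/-- `descentSigS_of_piecesSV` — seam of the TiltedLandingLaw421 descent framework, part 07 (token-identical port of `Cruxes/TiltedLandingLaw421/Lines/law421birthS.lean`; no new mathematics). -/
theorem descentSigS_of_piecesSV :
    SurplusLiftSigV (1 / 4) StCol WindowReady (SuccS (1 / 4)) → DescentSigS :=
  fun hL => descentSigS_of_liftV_pieces (1 / 4) le_rfl StCol WindowReady (SuccS (1 / 4)) init0Sig_stCol hL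
    (frozenStepSig_succS (1 / 4) WindowReady) landSig_stCol

example (hS : SurplusLiftSig 0 (liftBudget (1 / 4) 0 1) StCol WindowReady (FrozenLocS' cStar muF))
    (hF : FrozenStepSig (1 / 4) StCol WindowReady (FrozenLocS' cStar muF)) :
    SurplusLiftSig 0 (liftBudget (1 / 4) 0 1) StCol WindowReady (SuccS (1 / 4)) :=
  surplusLiftSig_succS_of_step hS hF

end RhIdea6.G19.W07C11.Seam
namespace RhW07.C11.DescentSplit.C3
/-- `SuccColAt` — seam of the TiltedLandingLaw421 descent framework, part 07 (token-identical port of `Cruxes/TiltedLandingLaw421/Lines/law421birthS.lean`; no new mathematics). -/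
def SuccColAt (d σ : ℝ) (g : ℂ → ℂ) (u : ℂ) : Prop :=
  ∃ z₁ : ℂ, deriv g z₁ = 0 ∧ 0 < z₁.im ∧ |z₁.re - u.re| ≤ σ ∧ z₁.im ≤ u.im - d

/-- `succColAt_successor` — seam of the TiltedLandingLaw421 descent framework, part 07 (token-identical port of `Cruxes/TiltedLandingLaw421/Lines/law421birthS.lean`; no new mathematics). -/
theorem succColAt_successor {d σ : ℝ} {f : ℂ → ℂ} {j : ℕ} {u : ℂ} (hS : SuccColAt d σ (iteratedDeriv j f) u) :
    ∃ z₁ : ℂ, iteratedDeriv (j + 1) f z₁ = 0 ∧ 0 < z₁.im ∧ |z₁.re - u.re| ≤ σ ∧ z₁.im ≤ u.im - d := by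
  obtain ⟨z₁, h1, h2, h3, h4⟩ := hS
  exact ⟨z₁, by rw [iteratedDeriv_succ]; exact h1, h2, h3, h4⟩


end RhW07.C11.DescentSplit.C3
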